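import Summits.ABC.IUTFork.Repair.RHSigmaLicenceInvariance
import HarnessLib

/-!
# R-H ROUND 2, Q2 (generic): the weakened Corollary IS «DEBT − CREDIT ≤ ε» — `R_∅` is the debt, and what the strata discard is the credit

abc-iut cell, rung LADDER-ABC:A2.RESCUE.H, R-H ROUND 2 seat abc-iut-rh2-q2-eq (gen 2). PROOF-ONLY sequel of `RHSigmaLicence.lean` (p468453) and
`RHSigmaLicenceInvariance.lean` (p476178), same generality (ANY `P : Cor312.Setting S`, bridge hypotheses `BridgeHyps P`). Written to give the Q1′ /
generation-pass seats (rh-lead MIN-SLICE, rh3-gen-2 «G2-CREDIT±», rh3-gen-7 «cross-place financing», rh-kit-2's SIGNED column) the exact kernel object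
behind «credit»: no new definition, the two signed sums are written out.

THE IDENTITY. Under the bridge hypotheses `−|log(Θ)| = PN(i ↦ Σᶠ_{v_ℚ} logvol ⁿ˚𝒰_{i+1,v_ℚ})` is a real number, so the weakened Corollary
`StatementUpTo P ε` («`−|log(q)| ≤ −|log(Θ)| + ε`») is EXACTLY the inequality
  `D(P) := PN(i ↦ Σᶠ_{v_ℚ} cellDeficit_{i,v_ℚ}) ≤ ε`                                   (`statementUpTo_iff_avg_cellDeficit_le`)
for the SIGNED averaged deficit `D(P)` (= minus abc-iut-rp-s2's averaged cell slack: `ObstructionSS28Window.statement_iff_avg_cellSlack` is the case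
`ε = 0`, re-derived here as `statement_iff_avg_cellDeficit_nonpos`). Splitting each cell's deficit into its positive and negative parts,
  `D(P) = R_∅(P) − C(P)`,  `R_∅ = PN Σᶠ (cellDeficit)⁺` (the DEBT = total positive deficit, p476178 `offRemainder_empty_eq`),
  `C := PN Σᶠ (−cellDeficit)⁺ ≥ 0` (the CREDIT = total surplus of the cells whose hull out-measures the q-region)   (`avg_cellDeficit_eq_offRemainder_empty_sub_credit`).
CONSEQUENCES (all PROVED): `StatementUpTo P ε ⟺ R_∅ − C ≤ ε` (`statementUpTo_iff_debt_sub_credit_le`); the [TOL]-type binder every Σ-row endpoint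
carries, «`R_∅ ≤ ε`» (p476178 `offRemainder_le_iff_of_licenceOn`), is the credit-free SUFFICIENT condition (`statementUpTo_of_offRemainder_empty_le`,
p476178) and is STRONGER than the Corollary-with-slack by exactly `C` — the strata framework is lossy by the credit and by nothing else; the printed
Statement is «debt ≤ credit» (`statement_iff_offRemainder_empty_le_credit`). A licensed stratum contributes ONLY to the credit
(`credit_ge_of_licenceOn`-type facts are immediate from p476178 §1 and are not spelled out beyond `creditOn`-free statements here).

HONEST FRAMING: bookkeeping identities about OUR typed objects; nothing here asserts that abc is proved or refuted, or that [IUTchIII] Cor. 3.12 holds or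
fails at any datum, or takes a side on any author; `D`, `R_∅`, `C` are DEFINED real numbers of a setting, never bounded numerically here; typed ≠ proved.
[claim: Mochizuki2012, status: disputed] for every IUT locution. [cite: Mochizuki2012, IUTchIII Cor. 3.12 p. 173–174, Prop. 3.9 (i)(iii) p. 116]
-/

noncomputable section

open Set Function

namespace Summit.ABC.IUTFork.Repair.RH.SigmaLicence

open Summit.ABC.IUTFork.Thm311 Summit.ABC.IUTFork.Cor312 Summit.ABC.IUTFork.Cor312.Setting Summit.ABC.IUTFork.Cor312Vol
  Literature.IUT.LogThetaLattice

variable {T : ThetaIndex} {S : Situation T} {P : Cor312.Setting S}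

/-! ## §1. Bookkeeping: `PN` is linear; the signed averaged deficit -/

/-- `PN (f − g) = PN f − PN g`. [folklore] -/
theorem processionNormalized_sub {lstar : ℕ} (f g : Fin lstar → ℝ) :
    processionNormalized (fun i => f i - g i) = processionNormalized f - processionNormalized g := by
  unfold processionNormalized
  rw [← sub_div, Finset.sum_sub_distrib]

/-- Per label, the (signed) deficit is finitely supported over `v_ℚ`. [folklore] -/
theorem cellDeficit_support_finite (H : BridgeHyps P) (i : Fin T.lstar) :
    (Function.support fun vQ : T.VQ => cellDeficit P i vQ).Finite := by
  refine ((qLocal_support_finite (P := P) i).union (hullLogvol_support_finite H i)).subset fun vQ hvQ => ?_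
  by_contra hn
  simp only [Set.mem_union, Function.mem_support, not_or, not_not] at hn
  exact hvQ (by show cellDeficit P i vQ = 0; unfold cellDeficit; rw [hn.1, hn.2, sub_zero])

/-- Per label, the positive part of the deficit is finitely supported. [folklore] -/
theorem posDeficit_support_finite (H : BridgeHyps P) (i : Fin T.lstar) :
    (Function.support fun vQ : T.VQ => max (cellDeficit P i vQ) 0).Finite :=
  (cellDeficit_support_finite H i).subset fun vQ hvQ => by
    by_contra hn
    simp only [Function.mem_support, ne_eq, not_not] at hn
    exact hvQ (by simp only [hn, max_self])

/-- Per label, the negative part of the deficit (the cell's CREDIT) is finitely supported. [folklore] -/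
theorem negDeficit_support_finite (H : BridgeHyps P) (i : Fin T.lstar) :
    (Function.support fun vQ : T.VQ => max (-cellDeficit P i vQ) 0).Finite :=
  (cellDeficit_support_finite H i).subset fun vQ hvQ => by
    by_contra hn
    simp only [Function.mem_support, ne_eq, not_not] at hn
    exact hvQ (by simp only [hn, neg_zero, max_self])

/-- Per label: `Σᶠ cellDeficit = Σᶠ qLocal − Σᶠ logvol(ⁿ˚𝒰)`. [folklore] -/
theorem finsum_cellDeficit_eq (H : BridgeHyps P) (i : Fin T.lstar) :
    ∑ᶠ vQ : T.VQ, cellDeficit P i vQ =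
      (∑ᶠ vQ : T.VQ, P.qLocal (labelSucc i) vQ) -
        ∑ᶠ vQ : T.VQ, (S.D P.n).logvol (labelSucc i) vQ (P.thetaHull (labelSucc i) vQ) := by
  unfold cellDeficit
  exact finsum_sub_distrib (qLocal_support_finite (P := P) i) (hullLogvol_support_finite H i)

/-- Under the bridge hypotheses `−|log(Θ)|` is the real number `PN(i ↦ Σᶠ logvol ⁿ˚𝒰_{i+1,v_ℚ})`. [claim: Mochizuki2012, status: disputed] -/
theorem negLogTheta_eq_coe (H : BridgeHyps P) :
    P.negLogTheta = ((processionNormalized fun i : Fin T.lstar =>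
      ∑ᶠ vQ : T.VQ, (S.D P.n).logvol (labelSucc i) vQ (P.thetaHull (labelSucc i) vQ) : ℝ) : WithTop ℝ) := by
  unfold Setting.negLogTheta
  rw [if_pos H.finite]
  simp only [thetaLocal_untopD H]

/-- **The signed averaged deficit is `−|log(q)| − (−|log(Θ)|)`** (as reals, bridge hypotheses): `PN Σᶠ cellDeficit = negLogQ − PN Σᶠ logvol(ⁿ˚𝒰)`.
[claim: Mochizuki2012, status: disputed] -/
theorem avg_cellDeficit_eq (H : BridgeHyps P) :
    processionNormalized (fun i : Fin T.lstar => ∑ᶠ vQ : T.VQ, cellDeficit P i vQ) =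
      P.negLogQ - processionNormalized fun i : Fin T.lstar =>
        ∑ᶠ vQ : T.VQ, (S.D P.n).logvol (labelSucc i) vQ (P.thetaHull (labelSucc i) vQ) := by
  unfold Setting.negLogQ
  rw [← processionNormalized_sub]
  exact congrArg processionNormalized (funext fun i => finsum_cellDeficit_eq H i)

/-! ## §2. The weakened Corollary is EXACTLY «signed averaged deficit ≤ ε» -/

/-- **`StatementUpTo P ε ⟺ PN Σᶠ cellDeficit ≤ ε`** (bridge hypotheses): the weakened Corollary is the inequality on the SIGNED averaged deficit,
credit and debt netted across all cells and labels. [claim: Mochizuki2012, status: disputed] -/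
theorem statementUpTo_iff_avg_cellDeficit_le (H : BridgeHyps P) (ε : ℝ) :
    StatementUpTo P ε ↔ processionNormalized (fun i : Fin T.lstar => ∑ᶠ vQ : T.VQ, cellDeficit P i vQ) ≤ ε := by
  unfold StatementUpTo
  rw [negLogTheta_eq_coe H, avg_cellDeficit_eq H, ← WithTop.coe_add, WithTop.coe_le_coe]
  simp only [ne_eq, WithTop.coe_ne_top, not_false_eq_true, true_and]
  constructor <;> intro h <;> linarith

/-- The printed Statement is «signed averaged deficit ≤ 0» (abc-iut-rp-s2's `ObstructionSS28Window.statement_iff_avg_cellSlack` with the sign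
flipped; here over the bridge hypotheses). [claim: Mochizuki2012, status: disputed] -/
theorem statement_iff_avg_cellDeficit_nonpos (H : BridgeHyps P) :
    P.Statement ↔ processionNormalized (fun i : Fin T.lstar => ∑ᶠ vQ : T.VQ, cellDeficit P i vQ) ≤ 0 := by
  rw [← statementUpTo_zero_iff]
  exact statementUpTo_iff_avg_cellDeficit_le H 0

/-! ## §3. DEBT − CREDIT: `PN Σᶠ cellDeficit = R_∅ − C` -/

/-- **`PN Σᶠ cellDeficit = R_∅ − C`**: the signed averaged deficit is the DEBT `R_∅ = PN Σᶠ (cellDeficit)⁺` (p476178 `offRemainder_empty_eq`) minus the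
CREDIT `C = PN Σᶠ (−cellDeficit)⁺ ≥ 0`. [claim: Mochizuki2012, status: disputed] -/
theorem avg_cellDeficit_eq_offRemainder_empty_sub_credit (H : BridgeHyps P) :
    processionNormalized (fun i : Fin T.lstar => ∑ᶠ vQ : T.VQ, cellDeficit P i vQ) =
      offRemainder P ∅ - processionNormalized fun i : Fin T.lstar => ∑ᶠ vQ : T.VQ, max (-cellDeficit P i vQ) 0 := by
  rw [offRemainder_empty_eq, ← processionNormalized_sub]
  refine congrArg processionNormalized (funext fun i => ?_)
  rw [← finsum_sub_distrib (posDeficit_support_finite H i) (negDeficit_support_finite H i)]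
  exact finsum_congr fun vQ => (max_zero_sub_max_neg_zero_eq_self _).symm

/-- The credit is non-negative. [folklore] -/
theorem credit_nonneg (P : Cor312.Setting S) :
    0 ≤ processionNormalized fun i : Fin T.lstar => ∑ᶠ vQ : T.VQ, max (-cellDeficit P i vQ) 0 :=
  processionNormalized_nonneg fun _ => finsum_nonneg fun _ => le_max_right _ _

/-- Hence the signed averaged deficit never exceeds the debt: `PN Σᶠ cellDeficit ≤ R_∅`. [claim: Mochizuki2012, status: disputed] -/
theorem avg_cellDeficit_le_offRemainder_empty (H : BridgeHyps P) :
    processionNormalized (fun i : Fin T.lstar => ∑ᶠ vQ : T.VQ, cellDeficit P i vQ) ≤ offRemainder P ∅ := by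
  rw [avg_cellDeficit_eq_offRemainder_empty_sub_credit H]
  linarith [credit_nonneg P]

/-- **`StatementUpTo P ε ⟺ R_∅ − C ≤ ε`** — the weakened Corollary in debt/credit form. The Σ-rows' common [TOL] binder «`R_∅ ≤ ε`» is the case that
FORGOES the credit: sufficient (`statementUpTo_of_offRemainder_empty_le`, p476178), stronger by exactly `C`. [claim: Mochizuki2012, status: disputed] -/
theorem statementUpTo_iff_debt_sub_credit_le (H : BridgeHyps P) (ε : ℝ) :
    StatementUpTo P ε ↔
      offRemainder P ∅ - processionNormalized (fun i : Fin T.lstar => ∑ᶠ vQ : T.VQ, max (-cellDeficit P i vQ) 0) ≤ ε := by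
  rw [statementUpTo_iff_avg_cellDeficit_le H ε, avg_cellDeficit_eq_offRemainder_empty_sub_credit H]

/-- **The printed Statement is «DEBT ≤ CREDIT»**: `Statement ⟺ R_∅ ≤ C`. [claim: Mochizuki2012, status: disputed] -/
theorem statement_iff_offRemainder_empty_le_credit (H : BridgeHyps P) :
    P.Statement ↔ offRemainder P ∅ ≤ processionNormalized fun i : Fin T.lstar => ∑ᶠ vQ : T.VQ, max (-cellDeficit P i vQ) 0 := by
  rw [← statementUpTo_zero_iff, statementUpTo_iff_debt_sub_credit_le H 0, sub_nonpos]

/-- The minimal slack: the weakened Corollary holds with `ε := PN Σᶠ cellDeficit` itself (and with no smaller `ε`). [claim: Mochizuki2012, status: disputed] -/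
theorem statementUpTo_avg_cellDeficit (H : BridgeHyps P) :
    StatementUpTo P (processionNormalized fun i : Fin T.lstar => ∑ᶠ vQ : T.VQ, cellDeficit P i vQ) :=
  (statementUpTo_iff_avg_cellDeficit_le H _).mpr le_rfl

/-- … and it is the LEAST such slack: `StatementUpTo P ε → PN Σᶠ cellDeficit ≤ ε`. [claim: Mochizuki2012, status: disputed] -/
theorem avg_cellDeficit_le_of_statementUpTo (H : BridgeHyps P) {ε : ℝ} (h : StatementUpTo P ε) :
    processionNormalized (fun i : Fin T.lstar => ∑ᶠ vQ : T.VQ, cellDeficit P i vQ) ≤ ε :=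
  (statementUpTo_iff_avg_cellDeficit_le H ε).mp h

/-! ## §4. Where the credit sits: licensed cells carry credit only, unlicensed positive-deficit cells carry debt only -/

/-- On a licence cell the deficit equals minus its credit (no debt there). [claim: Mochizuki2012, status: disputed] -/
theorem cellDeficit_eq_neg_credit_of_mem_licenceCells (H : BridgeHyps P) {t : Fin T.lstar × T.VQ} (ht : t ∈ licenceCells P) :
    cellDeficit P t.1 t.2 = -max (-cellDeficit P t.1 t.2) 0 := by
  rw [max_eq_left (by linarith [cellDeficit_nonpos_of_mem_licenceCells H ht]), neg_neg]

/-- A cell with positive deficit carries no credit. [folklore] -/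
theorem credit_eq_zero_of_pos {t : Fin T.lstar × T.VQ} (hpos : 0 < cellDeficit P t.1 t.2) :
    max (-cellDeficit P t.1 t.2) 0 = 0 :=
  max_eq_right (by linarith)

/-- **Debt-only reading recovers p476178**: if NO cell carries credit (every cell has deficit `≥ 0`) the weakened Corollary is EXACTLY «`R_∅ ≤ ε`».
[claim: Mochizuki2012, status: disputed] -/
theorem statementUpTo_iff_offRemainder_empty_le_of_forall_nonneg (H : BridgeHyps P)
    (h : ∀ t : Fin T.lstar × T.VQ, 0 ≤ cellDeficit P t.1 t.2) (ε : ℝ) :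
    StatementUpTo P ε ↔ offRemainder P ∅ ≤ ε := by
  rw [statementUpTo_iff_debt_sub_credit_le H ε]
  have hc : (processionNormalized fun i : Fin T.lstar => ∑ᶠ vQ : T.VQ, max (-cellDeficit P i vQ) 0) = 0 := by
    have hz : ∀ (i : Fin T.lstar) (vQ : T.VQ), max (-cellDeficit P i vQ) 0 = 0 :=
      fun i vQ => max_eq_right (by linarith [h (i, vQ)])
    simp only [hz, finsum_zero]
    exact processionNormalized_zero
  rw [hc, sub_zero]

end Summit.ABC.IUTFork.Repair.RH.SigmaLicence

end
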